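/-
Copyright: hsemireg programme, LADDER-HodgeAV H2 lens wave (req-36). Author seat: plan-lens-HodgeAV-anomaly g16 (evidence-only).
-/
import Summits.HodgeConjecture.HodgeConjecture.Cruxes.BlochSeedDiscOne.CoverCount

/-!
# CoverCountP — the P-side distinct-cell counts with ONE resp. ZERO off-axis letters, and the generic «64 ≤ m · #cells» form

Leaf over `CoverCount.lean` (anomaly g16, 3bfde141f3c86b3b) and negation's `BoxIdentity.lean` v2.  Nothing here is proved toward
HC ∕ HC_AV ∕ HC_CM ∕ H2 ∕ 18881; these are counting facts of the letter model (census-neutral).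

* `classA_card_mul` ∕ `classB_card_mul` : if every cell of `meetN k` (resp. `meetP (k+2)`) meets at most `m` boxes of the class, then
  in Branch A′(k) (resp. B′(k)) `64 ≤ m · #meetN` (resp. `#meetP`).  The per-cell bound `m` is `cap (offCount c)` from `CoverCount`
  (`6 ∕ 7 ∕ 10 ∕ 14 ∕ 21` for `0 ∕ 1 ∕ 2 ∕ 3 ∕ 4` off-axis letters).
* `classB_ten_cells`  : Branch B′ + «every hub-free P-support cell has ≤ 1 off-axis letter» ⇒ `10 ≤ #meetP (k+2)`.
  (Displayed hypothesis; it is the P-room shape announced at support level by gs-eng-2 g64 (bus l.13708 (B): no P `Cuuu ∕ Duuu` hooks,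
  `ABuu ∕ BBuu` dead where tested — hub-free P ⊆ `{u⁴, Auuu, Buuu, AAuu, AAAu, AAAA}`), to be discharged by a packaged fine P-type theorem.)
* `classB_eleven_cells` : Branch B′ + «hub-free P-support cells are axis-only» ⇒ `11 ≤ #meetP (k+2)` (same as `CoverCountFine.axis_eleven_P_cells`
  but stated over the bare `offCount = 0` room hypothesis at any height).
-/

namespace Summit.HodgeConjecture.HodgeConjecture.Cruxes.BlochSeedDiscOne.CoverCountP

open DepthBoundA4 BoxIdentity CoverCount

/-- Generic N-side form: a uniform per-cell bound `m` on the class-`k` boxes met turns the cover volume law into `64 ≤ m · #meetN`. -/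
theorem classA_card_mul (hgt : ℤ) (D : Design) (hO : D.OnAlphabet hgt) (hA : A1e D) (k : Fin 4) (m : ℕ)
    (hpos : 0 < 2 * Sigma hgt D - (ipow k * D.mu).re)
    (hm : ∀ c ∈ meetN hgt D k, (met hgt c k).card ≤ m) :
    64 ≤ m * (meetN hgt D k).card := by
  have hvol := classA_cover_volume hgt D hO hA k hpos
  have hle : ∑ c ∈ meetN hgt D k, (met hgt c k).card ≤ ∑ c ∈ meetN hgt D k, m :=
    Finset.sum_le_sum fun c hc => hm c hc
  rw [Finset.sum_const, smul_eq_mul] at hle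
  calc 64 ≤ ∑ c ∈ meetN hgt D k, (met hgt c k).card := hvol
    _ ≤ (meetN hgt D k).card * m := hle
    _ = m * (meetN hgt D k).card := Nat.mul_comm _ _

/-- Generic P-side form: in Branch B′(k), a uniform per-cell bound `m` on the class-`(k+2)` boxes met gives `64 ≤ m · #meetP`. -/
theorem classB_card_mul (hgt : ℤ) (D : Design) (hO : D.OnAlphabet hgt) (hA : A1e D) (k : Fin 4) (m : ℕ)
    (hk : 16 ≤ -(ipow k * D.mu).re) (hnonpos : 2 * Sigma hgt D - (ipow k * D.mu).re ≤ 0)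
    (hm : ∀ c ∈ meetP hgt D (k + 2), (met hgt c (k + 2)).card ≤ m) :
    64 ≤ m * (meetP hgt D (k + 2)).card := by
  have hvol := classB_cover_volume hgt D hO hA k hk hnonpos
  have hle : ∑ c ∈ meetP hgt D (k + 2), (met hgt c (k + 2)).card ≤ ∑ c ∈ meetP hgt D (k + 2), m :=
    Finset.sum_le_sum fun c hc => hm c hc
  rw [Finset.sum_const, smul_eq_mul] at hle
  calc 64 ≤ ∑ c ∈ meetP hgt D (k + 2), (met hgt c (k + 2)).card := hvol
    _ ≤ (meetP hgt D (k + 2)).card * m := hle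
    _ = m * (meetP hgt D (k + 2)).card := Nat.mul_comm _ _

/-- Per-cell bound on the P side from a room hypothesis on `offCount`. -/
theorem metP_card_le_of_room (hgt : ℤ) (D : Design) (hO : D.OnAlphabet hgt) (k : Fin 4) (n : ℕ)
    (hroom : ∀ c ∈ D.suppP, (∀ f : Fin 4, ¬((c f).x = 0 ∧ (c f).y = 0)) → offCount c ≤ n) :
    ∀ c ∈ meetP hgt D (k + 2), (met hgt c (k + 2)).card ≤ cap n := by
  intro c hc
  simp only [meetP, Finset.mem_filter, List.mem_toFinset] at hc
  have hcO : ∀ f : Fin 4, (c f).OnAlphabet hgt := fun f => hO c (List.mem_append_right _ hc.1) f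
  have hnh := hubfree_of_met_nonempty hgt c (k + 2) hcO hc.2
  have h1 := met_card_le hgt c (k + 2) hcO hnh
  have h2 : offCount c ≤ n := hroom c hc.1 hnh
  have h3 : cap (offCount c) ≤ cap n := by
    unfold cap; split_ifs <;> omega
  omega

/-- Per-cell bound on the N side from a room hypothesis on `offCount`. -/
theorem metN_card_le_of_room (hgt : ℤ) (D : Design) (hO : D.OnAlphabet hgt) (k : Fin 4) (n : ℕ)
    (hroom : ∀ c ∈ D.suppN, (∀ f : Fin 4, ¬((c f).x = 0 ∧ (c f).y = 0)) → offCount c ≤ n) :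
    ∀ c ∈ meetN hgt D k, (met hgt c k).card ≤ cap n := by
  intro c hc
  simp only [meetN, Finset.mem_filter, List.mem_toFinset] at hc
  have hcO : ∀ f : Fin 4, (c f).OnAlphabet hgt := fun f => hO c (List.mem_append_left _ hc.1) f
  have hnh := hubfree_of_met_nonempty hgt c k hcO hc.2
  have h1 := met_card_le hgt c k hcO hnh
  have h2 : offCount c ≤ n := hroom c hc.1 hnh
  have h3 : cap (offCount c) ≤ cap n := by
    unfold cap; split_ifs <;> omega
  omega

/-- **TEN DISTINCT P CELLS.** Branch B′ + «every hub-free P-support cell has at most one off-axis letter» ⇒ `10 ≤ #meetP (k+2)`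
(`cap 1 = 7`, `64 ≤ 7 · #cells`). -/
theorem classB_ten_cells (hgt : ℤ) (D : Design) (hO : D.OnAlphabet hgt) (hA : A1e D) (k : Fin 4)
    (hk : 16 ≤ -(ipow k * D.mu).re) (hnonpos : 2 * Sigma hgt D - (ipow k * D.mu).re ≤ 0)
    (hroom : ∀ c ∈ D.suppP, (∀ f : Fin 4, ¬((c f).x = 0 ∧ (c f).y = 0)) → offCount c ≤ 1) :
    10 ≤ (meetP hgt D (k + 2)).card := by
  have h := classB_card_mul hgt D hO hA k (cap 1) hk hnonpos (metP_card_le_of_room hgt D hO k 1 hroom)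
  have hc : cap 1 = 7 := by decide
  rw [hc] at h
  omega

/-- **ELEVEN DISTINCT P CELLS** for an axis-only hub-free P room (`cap 0 = 6`, `64 ≤ 6 · #cells`). -/
theorem classB_eleven_cells (hgt : ℤ) (D : Design) (hO : D.OnAlphabet hgt) (hA : A1e D) (k : Fin 4)
    (hk : 16 ≤ -(ipow k * D.mu).re) (hnonpos : 2 * Sigma hgt D - (ipow k * D.mu).re ≤ 0)
    (hroom : ∀ c ∈ D.suppP, (∀ f : Fin 4, ¬((c f).x = 0 ∧ (c f).y = 0)) → offCount c ≤ 0) :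
    11 ≤ (meetP hgt D (k + 2)).card := by
  have h := classB_card_mul hgt D hO hA k (cap 0) hk hnonpos (metP_card_le_of_room hgt D hO k 0 hroom)
  have hc : cap 0 = 6 := by decide
  rw [hc] at h
  omega

/-- **N side, parametric:** Branch A′ + «hub-free N-support cells have ≤ n off-axis letters» ⇒ `64 ≤ cap n · #meetN k`
(n = 0: ≥ 11; n = 1: ≥ 10; n = 2: ≥ 7; n = 3: ≥ 5; n = 4: ≥ 4). -/
theorem classA_card_mul_of_room (hgt : ℤ) (D : Design) (hO : D.OnAlphabet hgt) (hA : A1e D) (k : Fin 4) (n : ℕ)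
    (hpos : 0 < 2 * Sigma hgt D - (ipow k * D.mu).re)
    (hroom : ∀ c ∈ D.suppN, (∀ f : Fin 4, ¬((c f).x = 0 ∧ (c f).y = 0)) → offCount c ≤ n) :
    64 ≤ cap n * (meetN hgt D k).card :=
  classA_card_mul hgt D hO hA k (cap n) hpos (metN_card_le_of_room hgt D hO k n hroom)

/-- **P side, parametric:** Branch B′ + «hub-free P-support cells have ≤ n off-axis letters» ⇒ `64 ≤ cap n · #meetP (k+2)`. -/
theorem classB_card_mul_of_room (hgt : ℤ) (D : Design) (hO : D.OnAlphabet hgt) (hA : A1e D) (k : Fin 4) (n : ℕ)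
    (hk : 16 ≤ -(ipow k * D.mu).re) (hnonpos : 2 * Sigma hgt D - (ipow k * D.mu).re ≤ 0)
    (hroom : ∀ c ∈ D.suppP, (∀ f : Fin 4, ¬((c f).x = 0 ∧ (c f).y = 0)) → offCount c ≤ n) :
    64 ≤ cap n * (meetP hgt D (k + 2)).card :=
  classB_card_mul hgt D hO hA k (cap n) hk hnonpos (metP_card_le_of_room hgt D hO k n hroom)

end Summit.HodgeConjecture.HodgeConjecture.Cruxes.BlochSeedDiscOne.CoverCountP
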